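import Literature.AlgebraicGeometry.Resolution.AffineBlowupResolutionCriterion
import Literature.AlgebraicGeometry.Resolution.MarkedIdealsEtale
import HarnessLib

/-!
# Crux `FrobeniusLadder.FRationalResolution` (stmt-ResolutionOfSingularities-15317), line `redirect`,
# stub `stub_diagonalizableQuotientResolution` — **points of an affine blow-up via the chart rings `R[I/x_i]`**
# (brick P7-c2 of memo MEMO-15317-leafhand2-g8 §7: the pointwise form of
# `affineBlowup.isRegular_of_isRegularLocalRing_localization`, so that the ring-level classification of the
# primes of the chart algebras `C[(χ s)/χ h]` (`…ConeChartNextRound`) can be read on the points of `Bl`)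

Generic. For `I ⊆ R` (`R` Noetherian) and a generating family `x_i ∈ I`: every point `p` of `Bl_I(Spec R)` lies in
a chart `D₊(x_i t) ≅ Spec R[I/x_i]` and corresponds to a prime `𝔔` of the affine blowup algebra `R[I/x_i]`
(`blowupAlgebra I (x i)`) with `𝔔 ∩ R = π(p)` and `𝒪_{Bl, p}` regular iff `R[I/x_i]_𝔔` regular.

* (uses `affineBlowup.awayι_reesT_π` — the chart `Spec (R[It])_{(x t)} → Bl_I(Spec R) → Spec R` is `Spec` of the
  structure map);
* `isRegularLocalRing_localization_iff_of_ringEquiv` — transport of regularity of localizations along a ring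
  isomorphism;
* **`exists_chart_prime`** — the statement above.

Honest label: scheme plumbing toward ONE leaf stub (no stub, crux or summit closed). No definitions, no named
facts, no sorry. [cite: StacksProject, Tag 0804] [cite: GortzWedhorn2020, (13.19) p. 415]
-/

noncomputable section

open CategoryTheory AlgebraicGeometry TopologicalSpace
open Literature.AlgebraicGeometry.Resolution

-- single-problem summit: the doubled namespace component is forced
set_option linter.dupNamespace false

namespace Summit.ResolutionOfSingularities.ResolutionOfSingularities.Theorems.FRationalResolution.BlowupChartPoints

variable {R : Type} [CommRing R] (I : Ideal R)

/-- Transport of regularity of localizations at corresponding primes along a ring isomorphism. [folklore] -/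
theorem isRegularLocalRing_localization_iff_of_ringEquiv {S T : Type} [CommRing S] [CommRing T] (e : S ≃+* T)
    (P : Ideal S) [P.IsPrime] (𝔔 : Ideal T) [𝔔.IsPrime] (hP : ∀ s, s ∈ P ↔ e s ∈ 𝔔) :
    IsRegularLocalRing (Localization.AtPrime P) ↔ IsRegularLocalRing (Localization.AtPrime 𝔔) := by
  have H : Submonoid.map e.toMonoidHom P.primeCompl = 𝔔.primeCompl := by
    ext t
    constructor
    · rintro ⟨s, hs, rfl⟩
      exact fun ht => hs ((hP s).mpr ht)
    · intro ht
      refine ⟨e.symm t, fun hs => ht ?_, by simp⟩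
      have := (hP _).mp hs
      rwa [RingEquiv.apply_symm_apply] at this
  let f : Localization.AtPrime P ≃+* Localization.AtPrime 𝔔 :=
    IsLocalization.ringEquivOfRingEquiv (Localization.AtPrime P) (Localization.AtPrime 𝔔) e H
  exact ⟨fun h => IsRegularLocalRing.of_ringEquiv f, fun h => IsRegularLocalRing.of_ringEquiv f.symm⟩

/-- **Points of `Bl_I(Spec R)` via the chart rings.** For `R` Noetherian and a generating family `x_i` of
`I`: every `p ∈ Bl_I(Spec R)` admits an index `i` and a prime `𝔔` of `R[I/x_i]` with `𝔔 ∩ R = π(p)` and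
`𝒪_{Bl_I(Spec R), p}` regular iff `R[I/x_i]_𝔔` regular. [cite: StacksProject, Tag 0804]
[cite: GortzWedhorn2020, (13.19) p. 415] -/
theorem exists_chart_prime [IsNoetherianRing R] {ι : Type*} (x : ι → R) (hxI : ∀ i, x i ∈ I)
    (hI : I ≤ Ideal.span (Set.range x)) (p : affineBlowup I) :
    ∃ (i : ι) (𝔔 : Ideal (blowupAlgebra I (x i))) (_ : 𝔔.IsPrime),
      𝔔.comap (algebraMap R (blowupAlgebra I (x i))) = (affineBlowup.π I p).asIdeal ∧
      (IsRegularLocalRing ((affineBlowup I).presheaf.stalk p) ↔ IsRegularLocalRing (Localization.AtPrime 𝔔)) := by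
  classical
  -- the chart containing `p`
  have hp : p ∈ ⨆ i, Proj.basicOpen (reesGrading I) (reesT (x i) (hxI i)) := by
    rw [affineBlowup.iSup_basicOpen_reesT_eq_top_of_le x hxI hI]; trivial
  obtain ⟨i, hi⟩ := Opens.mem_iSup.mp hp
  have hrange : p ∈ (Proj.awayι (reesGrading I) (reesT (x i) (hxI i)) (reesT_mem (x i) (hxI i)) one_pos).opensRange := by
    rw [Proj.opensRange_awayι]; exact hi
  obtain ⟨q, hq⟩ := hrange
  -- the chart ring and the blowup algebra
  haveI : IsNoetherianRing (blowupAlgebra I (x i)) := isNoetherianRing_blowupAlgebra_of_isNoetherianRing I (x i)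
  haveI : IsNoetherianRing (HomogeneousLocalization.Away (reesGrading I) (reesT (x i) (hxI i))) :=
    isNoetherianRing_of_ringEquiv _ (reesChartEquiv (I := I) (x i) (hxI i)).symm
  haveI : IsLocallyNoetherian (affineBlowup I) := LocallyOfFiniteType.isLocallyNoetherian (affineBlowup.π I)
  obtain ⟨𝔔, h𝔔def⟩ : ∃ 𝔔 : Ideal (blowupAlgebra I (x i)),
      𝔔 = q.asIdeal.comap (reesChartEquiv (I := I) (x i) (hxI i)).symm := ⟨_, rfl⟩
  have hmem𝔔 : ∀ b : blowupAlgebra I (x i), b ∈ 𝔔 ↔ (reesChartEquiv (I := I) (x i) (hxI i)).symm b ∈ q.asIdeal := by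
    intro b; rw [h𝔔def, Ideal.mem_comap]
  haveI h𝔔 : 𝔔.IsPrime := by rw [h𝔔def]; exact Ideal.IsPrime.comap _
  have hmemq : ∀ s, s ∈ q.asIdeal ↔ reesChartEquiv (I := I) (x i) (hxI i) s ∈ 𝔔 := by
    intro s; rw [hmem𝔔, RingEquiv.symm_apply_apply]
  refine ⟨i, 𝔔, h𝔔, ?_, ?_⟩
  · -- `𝔔 ∩ R = π p`
    have h1 : affineBlowup.π I p = Spec.map (CommRingCat.ofHom (reesChartBase (x i) (hxI i))) q := by
      rw [← hq, ← Scheme.Hom.comp_apply, affineBlowup.awayι_reesT_π]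
    rw [h1]
    ext r
    rw [Ideal.mem_comap]
    change algebraMap R (blowupAlgebra I (x i)) r ∈ 𝔔 ↔ reesChartBase (x i) (hxI i) r ∈ q.asIdeal
    rw [hmemq, reesChartEquiv_reesChartBase]
  · -- regularity: stalk at `p` = stalk of the chart at `q` = localization of the chart ring
    rw [← hq, ← isRegularLocalRing_stalk_iff_of_etale
      (Proj.awayι (reesGrading I) (reesT (x i) (hxI i)) (reesT_mem (x i) (hxI i)) one_pos) q]
    letI : Algebra (HomogeneousLocalization.Away (reesGrading I) (reesT (x i) (hxI i)))
        ((Spec (.of (HomogeneousLocalization.Away (reesGrading I) (reesT (x i) (hxI i))))).presheaf.stalk q) :=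
      (StructureSheaf.toStalk _ q).hom.toAlgebra
    have hloc : IsLocalization.AtPrime
        ((Spec (.of (HomogeneousLocalization.Away (reesGrading I) (reesT (x i) (hxI i))))).presheaf.stalk q)
        q.asIdeal := StructureSheaf.IsLocalization.to_stalk _ q
    let f := (IsLocalization.algEquiv q.asIdeal.primeCompl
      ((Spec (.of (HomogeneousLocalization.Away (reesGrading I) (reesT (x i) (hxI i))))).presheaf.stalk q)
      (Localization.AtPrime q.asIdeal)).toRingEquiv
    have h2 : IsRegularLocalRing ((Spec (.of (HomogeneousLocalization.Away (reesGrading I)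
        (reesT (x i) (hxI i))))).presheaf.stalk q) ↔ IsRegularLocalRing (Localization.AtPrime q.asIdeal) :=
      ⟨fun h => IsRegularLocalRing.of_ringEquiv f, fun h => IsRegularLocalRing.of_ringEquiv f.symm⟩
    rw [h2]
    -- the localizations at `q` and `𝔔` are isomorphic along `reesChartEquiv`
    exact isRegularLocalRing_localization_iff_of_ringEquiv (reesChartEquiv (I := I) (x i) (hxI i)) q.asIdeal 𝔔 hmemq

end Summit.ResolutionOfSingularities.ResolutionOfSingularities.Theorems.FRationalResolution.BlowupChartPoints

end

/-! ## Appendix (same generation): the chart point and the prime, explicitly -/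

noncomputable section

open CategoryTheory AlgebraicGeometry TopologicalSpace
open Literature.AlgebraicGeometry.Resolution

-- single-problem summit: the doubled namespace component is forced
set_option linter.dupNamespace false

namespace Summit.ResolutionOfSingularities.ResolutionOfSingularities.Theorems.FRationalResolution.BlowupChartPoints

/-- **Points of `Bl_I(Spec R)` via the chart rings, with the chart point exposed**: as `exists_chart_prime`,
and moreover `p = awayι(q)` for the point `q` of the chart `Spec (R[It])_{(x_i t)}` whose prime corresponds to `𝔔`
under `reesChartEquiv` (so distinct `p` in the same chart give distinct `𝔔`: the singular points of `Bl` inject into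
the singular chart primes). [cite: StacksProject, Tag 0804] [cite: GortzWedhorn2020, (13.19) p. 415] -/
theorem exists_chart_point_prime {R : Type} [CommRing R] (I : Ideal R) [IsNoetherianRing R] {ι : Type*}
    (x : ι → R) (hxI : ∀ i, x i ∈ I) (hI : I ≤ Ideal.span (Set.range x)) (p : affineBlowup I) :
    ∃ (i : ι) (q : Spec (.of (HomogeneousLocalization.Away (reesGrading I) (reesT (x i) (hxI i)))))
      (𝔔 : Ideal (blowupAlgebra I (x i))) (_ : 𝔔.IsPrime),
      Proj.awayι (reesGrading I) (reesT (x i) (hxI i)) (reesT_mem (x i) (hxI i)) one_pos q = p ∧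
      (∀ s, s ∈ q.asIdeal ↔ reesChartEquiv (I := I) (x i) (hxI i) s ∈ 𝔔) ∧
      𝔔.comap (algebraMap R (blowupAlgebra I (x i))) = (affineBlowup.π I p).asIdeal ∧
      (IsRegularLocalRing ((affineBlowup I).presheaf.stalk p) ↔ IsRegularLocalRing (Localization.AtPrime 𝔔)) := by
  classical
  have hp : p ∈ ⨆ i, Proj.basicOpen (reesGrading I) (reesT (x i) (hxI i)) := by
    rw [affineBlowup.iSup_basicOpen_reesT_eq_top_of_le x hxI hI]; trivial
  obtain ⟨i, hi⟩ := Opens.mem_iSup.mp hp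
  have hrange : p ∈ (Proj.awayι (reesGrading I) (reesT (x i) (hxI i)) (reesT_mem (x i) (hxI i)) one_pos).opensRange := by
    rw [Proj.opensRange_awayι]; exact hi
  obtain ⟨q, hq⟩ := hrange
  haveI : IsNoetherianRing (blowupAlgebra I (x i)) := isNoetherianRing_blowupAlgebra_of_isNoetherianRing I (x i)
  haveI : IsNoetherianRing (HomogeneousLocalization.Away (reesGrading I) (reesT (x i) (hxI i))) :=
    isNoetherianRing_of_ringEquiv _ (reesChartEquiv (I := I) (x i) (hxI i)).symm
  haveI : IsLocallyNoetherian (affineBlowup I) := LocallyOfFiniteType.isLocallyNoetherian (affineBlowup.π I)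
  obtain ⟨𝔔, h𝔔def⟩ : ∃ 𝔔 : Ideal (blowupAlgebra I (x i)),
      𝔔 = q.asIdeal.comap (reesChartEquiv (I := I) (x i) (hxI i)).symm := ⟨_, rfl⟩
  have hmem𝔔 : ∀ b : blowupAlgebra I (x i), b ∈ 𝔔 ↔ (reesChartEquiv (I := I) (x i) (hxI i)).symm b ∈ q.asIdeal := by
    intro b; rw [h𝔔def, Ideal.mem_comap]
  haveI h𝔔 : 𝔔.IsPrime := by rw [h𝔔def]; exact Ideal.IsPrime.comap _
  have hmemq : ∀ s, s ∈ q.asIdeal ↔ reesChartEquiv (I := I) (x i) (hxI i) s ∈ 𝔔 := by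
    intro s; rw [hmem𝔔, RingEquiv.symm_apply_apply]
  refine ⟨i, q, 𝔔, h𝔔, hq, hmemq, ?_, ?_⟩
  · have h1 : affineBlowup.π I p = Spec.map (CommRingCat.ofHom (reesChartBase (x i) (hxI i))) q := by
      rw [← hq, ← Scheme.Hom.comp_apply, affineBlowup.awayι_reesT_π]
    rw [h1]
    ext r
    rw [Ideal.mem_comap]
    change algebraMap R (blowupAlgebra I (x i)) r ∈ 𝔔 ↔ reesChartBase (x i) (hxI i) r ∈ q.asIdeal
    rw [hmemq, reesChartEquiv_reesChartBase]
  · rw [← hq, ← isRegularLocalRing_stalk_iff_of_etale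
      (Proj.awayι (reesGrading I) (reesT (x i) (hxI i)) (reesT_mem (x i) (hxI i)) one_pos) q]
    letI : Algebra (HomogeneousLocalization.Away (reesGrading I) (reesT (x i) (hxI i)))
        ((Spec (.of (HomogeneousLocalization.Away (reesGrading I) (reesT (x i) (hxI i))))).presheaf.stalk q) :=
      (StructureSheaf.toStalk _ q).hom.toAlgebra
    have hloc : IsLocalization.AtPrime
        ((Spec (.of (HomogeneousLocalization.Away (reesGrading I) (reesT (x i) (hxI i))))).presheaf.stalk q)
        q.asIdeal := StructureSheaf.IsLocalization.to_stalk _ q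
    let f := (IsLocalization.algEquiv q.asIdeal.primeCompl
      ((Spec (.of (HomogeneousLocalization.Away (reesGrading I) (reesT (x i) (hxI i))))).presheaf.stalk q)
      (Localization.AtPrime q.asIdeal)).toRingEquiv
    have h2 : IsRegularLocalRing ((Spec (.of (HomogeneousLocalization.Away (reesGrading I)
        (reesT (x i) (hxI i))))).presheaf.stalk q) ↔ IsRegularLocalRing (Localization.AtPrime q.asIdeal) :=
      ⟨fun h => IsRegularLocalRing.of_ringEquiv f, fun h => IsRegularLocalRing.of_ringEquiv f.symm⟩
    rw [h2]
    exact isRegularLocalRing_localization_iff_of_ringEquiv (reesChartEquiv (I := I) (x i) (hxI i)) q.asIdeal 𝔔 hmemq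

end Summit.ResolutionOfSingularities.ResolutionOfSingularities.Theorems.FRationalResolution.BlowupChartPoints

end
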